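import Mathlib

/-!
# Sharpness of the plateau length law at reach 3, 5 and 7: explicit plateaus with `d + 2` consecutive steps

Cell pub-symmetroid, seat conjb-2 (g22). A helper toward the crux `TropicalB`
(`Summit.ValiantsHypothesis.ValiantsHypothesis.Theses.KPlusLogSqLaw.TropicalB`, item
`stmt-ValiantsHypothesis-19771`); it earns no crux credit and is not evidence for `MatrixDescartes` or for
Valiant's hypothesis. Mathlib only; no definitions.

Setting (static path model, as in the `KPlusLogSqLawStep*` files): lines `S_t(θ) = b t + s t * θ`, even indices form the
upper class; the window `[j, j+d]` is separated at `θ` iff every even-indexed line of the window is strictly above every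
odd-indexed one there; row `j` of odd reach `d` STEPS iff the separation sets of `[j, j+d]` and `[j+1, j+d+1]` are both
non-empty and disjoint. THE PLATEAU LENGTH LAW (THEORY-NOTE-g22 §1, pencil, from the four-step law, the continuation law
and its index-reversal mirror): at odd reach `d ≥ 3` at most `d + 2` consecutive rows step. THIS FILE certifies that the
bound is ATTAINED at `d = 3`, `d = 5` and `d = 7` by explicit integer configurations found by the seat's LP decision
procedure (`tools/lpfeas.py`, exact re-solve `tools/lpfeas_exact.py`, targeted random search `tools/tight_search.py`;
HOME/pub-symmetroid-conjb-2/g22/runs/tight_d5_d3.txt, tight_d7.txt): `five_steps_reach_three` — 9 lines, rows `0..4`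
step (directions R,R,R,R,L); `seven_steps_reach_five_monotone` — 13 lines, rows `0..6` step and the eight window points
are strictly increasing (a MONOTONE seven-step plateau; at reach 3 no monotone five-step plateau exists, located);
`nine_steps_reach_seven` — 17 lines, rows `0..8` step (directions R⁸ then L). Each theorem states: (i) window `[j, j+d]`
is separated at the listed point `θ j` for every `j ≤ k`; (ii) for every `j < k` no real `x` separates both `[j, j+d]`
and `[j+1, j+d+1]` (proved from one binding pair in each of the two windows: an even/odd pair whose order at `x` bounds
`x` from above in one window and from below in the other, with coincident or crossed roots); (iii) (monotone case)
`θ j < θ (j+1)`. A monotone nine-step plateau at reach 7 is located too (runs/tight_d7_mono.txt, not certified here);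
reach 9 is beyond the seat's local search budget. CONJECTURE (THEORY-NOTE-g22 §1bis): the bound `d + 2` is attained at
every odd reach `d ≥ 3`.
-/

set_option linter.dupNamespace false

namespace Summit.ValiantsHypothesis.ValiantsHypothesis.Theorems.KPlusLogSqLawStepSharp

/-- Reach `d = 3`: five consecutive steps (rows `0..4`, directions R,R,R,R,L) — the length bound `d + 2 = 5` is attained. -/
theorem five_steps_reach_three : ∃ s b θ : ℕ → ℝ,
    (∀ j : ℕ, j ≤ 5 → ∀ e o : ℕ, j ≤ e → e ≤ j + 3 → j ≤ o → o ≤ j + 3 → Even e → ¬ Even o →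
        b o + s o * θ j < b e + s e * θ j) ∧
    (∀ j : ℕ, j < 5 → ∀ x : ℝ, (∀ e o : ℕ, j ≤ e → e ≤ j + 3 → j ≤ o → o ≤ j + 3 → Even e → ¬ Even o →
        b o + s o * x < b e + s e * x) →
      (∀ e o : ℕ, j + 1 ≤ e → e ≤ j + 1 + 3 → j + 1 ≤ o → o ≤ j + 1 + 3 → Even e → ¬ Even o →
        b o + s o * x < b e + s e * x) → False) := by
  refine ⟨fun t => if t = 0 then 4 else if t = 1 then 5 else if t = 2 then 3 else if t = 3 then 7 else if t = 4 then
      6 else if t = 5 then 0 else if t = 6 then 8 else if t = 7 then 2 else if t = 8 then 1 else 0,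
    fun t => if t = 0 then 0 else if t = 1 then -12 else if t = 2 then 138 else if t = 3 then -190 else if t = 4
      then -24 else if t = 5 then 363 else if t = 6 then -272 else if t = 7 then 640 else if t = 8 then 806 else 0,
    fun t => if t = 0 then 0 else if t = 1 then 24 else if t = 2 then 79 else if t = 3 then 94 else if t = 4 then
      169 else if t = 5 then 154 else 0, ?_, ?_⟩
  · intro j hj e o h1 h2 h3 h4 he ho
    interval_cases j <;> interval_cases e <;> interval_cases o <;>
      first
        | exact absurd he (by decide)
        | exact absurd (by decide) ho
        | norm_num
  · intro j hj x hx hy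
    interval_cases j
    · have a := hx 0 1 (by norm_num) (by norm_num) (by norm_num) (by norm_num) ⟨0, rfl⟩
        (by rw [Nat.even_iff]; norm_num)
      have c := hy 4 1 (by norm_num) (by norm_num) (by norm_num) (by norm_num) ⟨2, rfl⟩
        (by rw [Nat.even_iff]; norm_num)
      simp only at a c
      norm_num at a c
      linarith
    · have a := hx 2 1 (by norm_num) (by norm_num) (by norm_num) (by norm_num) ⟨1, rfl⟩
        (by rw [Nat.even_iff]; norm_num)
      have c := hy 2 5 (by norm_num) (by norm_num) (by norm_num) (by norm_num) ⟨1, rfl⟩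
        (by rw [Nat.even_iff]; norm_num)
      simp only at a c
      norm_num at a c
      linarith
    · have a := hx 2 3 (by norm_num) (by norm_num) (by norm_num) (by norm_num) ⟨1, rfl⟩
        (by rw [Nat.even_iff]; norm_num)
      have c := hy 6 3 (by norm_num) (by norm_num) (by norm_num) (by norm_num) ⟨3, rfl⟩
        (by rw [Nat.even_iff]; norm_num)
      simp only at a c
      norm_num at a c
      linarith
    · have a := hx 4 3 (by norm_num) (by norm_num) (by norm_num) (by norm_num) ⟨2, rfl⟩
        (by rw [Nat.even_iff]; norm_num)
      have c := hy 4 7 (by norm_num) (by norm_num) (by norm_num) (by norm_num) ⟨2, rfl⟩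
        (by rw [Nat.even_iff]; norm_num)
      simp only at a c
      norm_num at a c
      linarith
    · have a := hx 4 7 (by norm_num) (by norm_num) (by norm_num) (by norm_num) ⟨2, rfl⟩
        (by rw [Nat.even_iff]; norm_num)
      have c := hy 8 7 (by norm_num) (by norm_num) (by norm_num) (by norm_num) ⟨4, rfl⟩
        (by rw [Nat.even_iff]; norm_num)
      simp only at a c
      norm_num at a c
      linarith

/-- Reach `d = 5`: seven consecutive steps (rows `0..6`), all to the right (`θ 0 < θ 1 < ⋯ < θ 7`) — the length bound
`d + 2 = 7` is attained, monotonically. -/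
theorem seven_steps_reach_five_monotone : ∃ s b θ : ℕ → ℝ,
    (∀ j : ℕ, j ≤ 7 → ∀ e o : ℕ, j ≤ e → e ≤ j + 5 → j ≤ o → o ≤ j + 5 → Even e → ¬ Even o →
        b o + s o * θ j < b e + s e * θ j) ∧
    (∀ j : ℕ, j < 7 → ∀ x : ℝ, (∀ e o : ℕ, j ≤ e → e ≤ j + 5 → j ≤ o → o ≤ j + 5 → Even e → ¬ Even o →
        b o + s o * x < b e + s e * x) →
      (∀ e o : ℕ, j + 1 ≤ e → e ≤ j + 1 + 5 → j + 1 ≤ o → o ≤ j + 1 + 5 → Even e → ¬ Even o →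
        b o + s o * x < b e + s e * x) → False) ∧
    (∀ j : ℕ, j < 7 → θ j < θ (j + 1)) := by
  refine ⟨fun t => if t = 0 then 5 else if t = 1 then 6 else if t = 2 then 3 else if t = 3 then 4 else if t = 4 then
      2 else if t = 5 then 11 else if t = 6 then 7 else if t = 7 then 1 else if t = 8 then 10 else if t = 9 then 0
      else if t = 10 then 12 else if t = 11 then 8 else if t = 12 then 9 else 0,
    fun t => if t = 0 then 0 else if t = 1 then -369 else if t = 2 then 1026 else if t = 3 then -72 else if t = 4
      then 2220 else if t = 5 then -8490 else if t = 6 then -738 else if t = 7 then 1956 else if t = 8 then -6660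
      else if t = 9 then 4512 else if t = 10 then -9680 else if t = 11 then -2784 else if t = 12 then -14412 else 0,
    fun t => if t = 0 then 0 else if t = 1 then 441 else if t = 2 then 501 else if t = 3 then 1110 else if t = 4
      then 1182 else if t = 5 then 1262 else if t = 6 then 1974 else if t = 7 then 11700 else 0, ?_, ?_, ?_⟩
  · intro j hj e o h1 h2 h3 h4 he ho
    interval_cases j <;> interval_cases e <;> interval_cases o <;>
      first
        | exact absurd he (by decide)
        | exact absurd (by decide) ho
        | norm_num
  · intro j hj x hx hy
    interval_cases j
    · have a := hx 0 1 (by norm_num) (by norm_num) (by norm_num) (by norm_num) ⟨0, rfl⟩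
        (by rw [Nat.even_iff]; norm_num)
      have c := hy 6 1 (by norm_num) (by norm_num) (by norm_num) (by norm_num) ⟨3, rfl⟩
        (by rw [Nat.even_iff]; norm_num)
      simp only at a c
      norm_num at a c
      linarith
    · have a := hx 2 1 (by norm_num) (by norm_num) (by norm_num) (by norm_num) ⟨1, rfl⟩
        (by rw [Nat.even_iff]; norm_num)
      have c := hy 2 7 (by norm_num) (by norm_num) (by norm_num) (by norm_num) ⟨1, rfl⟩
        (by rw [Nat.even_iff]; norm_num)
      simp only at a c
      norm_num at a c
      linarith
    · have a := hx 2 3 (by norm_num) (by norm_num) (by norm_num) (by norm_num) ⟨1, rfl⟩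
        (by rw [Nat.even_iff]; norm_num)
      have c := hy 8 3 (by norm_num) (by norm_num) (by norm_num) (by norm_num) ⟨4, rfl⟩
        (by rw [Nat.even_iff]; norm_num)
      simp only at a c
      norm_num at a c
      linarith
    · have a := hx 4 3 (by norm_num) (by norm_num) (by norm_num) (by norm_num) ⟨2, rfl⟩
        (by rw [Nat.even_iff]; norm_num)
      have c := hy 4 9 (by norm_num) (by norm_num) (by norm_num) (by norm_num) ⟨2, rfl⟩
        (by rw [Nat.even_iff]; norm_num)
      simp only at a c
      norm_num at a c
      linarith
    · have a := hx 4 5 (by norm_num) (by norm_num) (by norm_num) (by norm_num) ⟨2, rfl⟩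
        (by rw [Nat.even_iff]; norm_num)
      have c := hy 10 5 (by norm_num) (by norm_num) (by norm_num) (by norm_num) ⟨5, rfl⟩
        (by rw [Nat.even_iff]; norm_num)
      simp only at a c
      norm_num at a c
      linarith
    · have a := hx 6 5 (by norm_num) (by norm_num) (by norm_num) (by norm_num) ⟨3, rfl⟩
        (by rw [Nat.even_iff]; norm_num)
      have c := hy 8 11 (by norm_num) (by norm_num) (by norm_num) (by norm_num) ⟨4, rfl⟩
        (by rw [Nat.even_iff]; norm_num)
      simp only at a c
      norm_num at a c
      linarith
    · have a := hx 6 11 (by norm_num) (by norm_num) (by norm_num) (by norm_num) ⟨3, rfl⟩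
        (by rw [Nat.even_iff]; norm_num)
      have c := hy 12 7 (by norm_num) (by norm_num) (by norm_num) (by norm_num) ⟨6, rfl⟩
        (by rw [Nat.even_iff]; norm_num)
      simp only at a c
      norm_num at a c
      linarith
  · intro j hj
    interval_cases j <;> simp <;> norm_num

/-- Reach `d = 7`: nine consecutive steps (rows `0..8`, directions R⁸ then L) — the length bound `d + 2 = 9` is attained. -/
theorem nine_steps_reach_seven : ∃ s b θ : ℕ → ℝ,
    (∀ j : ℕ, j ≤ 9 → ∀ e o : ℕ, j ≤ e → e ≤ j + 7 → j ≤ o → o ≤ j + 7 → Even e → ¬ Even o →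
        b o + s o * θ j < b e + s e * θ j) ∧
    (∀ j : ℕ, j < 9 → ∀ x : ℝ, (∀ e o : ℕ, j ≤ e → e ≤ j + 7 → j ≤ o → o ≤ j + 7 → Even e → ¬ Even o →
        b o + s o * x < b e + s e * x) →
      (∀ e o : ℕ, j + 1 ≤ e → e ≤ j + 1 + 7 → j + 1 ≤ o → o ≤ j + 1 + 7 → Even e → ¬ Even o →
        b o + s o * x < b e + s e * x) → False) := by
  refine ⟨fun t => if t = 0 then 4 else if t = 1 then 9 else if t = 2 then 8 else if t = 3 then 10 else if t = 4
      then 7 else if t = 5 then 12 else if t = 6 then 0 else if t = 7 then 15 else if t = 8 then 11 else if t = 9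
      then 5 else if t = 10 then 14 else if t = 11 then 1 else if t = 12 then 16 else if t = 13 then 6 else if t =
      14 then 13 else if t = 15 then 3 else if t = 16 then 2 else 0,
    fun t => if t = 0 then 0 else if t = 1 then -1320 else if t = 2 then 924 else if t = 3 then -5764 else if t = 4
      then 6578 else if t = 5 then -16412 else if t = 6 then 193204 else if t = 7 then -473336 else if t = 8 then
      -1848 else if t = 9 then 7656 else if t = 10 then -19140 else if t = 11 then 31262 else if t = 12 then -34804
      else if t = 13 then 85492 else if t = 14 then -347832 else if t = 15 then 1440168 else if t = 16 then 1620420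
      else 0,
    fun t => if t = 0 then 0 else if t = 1 then 924 else if t = 2 then 2684 else if t = 3 then 3674 else if t = 4
      then 4334 else if t = 5 then 4928 else if t = 6 then 17732 else if t = 7 then 62092 else if t = 8 then 180417
      else if t = 9 then 178932 else 0, ?_, ?_⟩
  · intro j hj e o h1 h2 h3 h4 he ho
    interval_cases j <;> interval_cases e <;> interval_cases o <;>
      first
        | exact absurd he (by decide)
        | exact absurd (by decide) ho
        | norm_num
  · intro j hj x hx hy
    interval_cases j
    · have a := hx 0 1 (by norm_num) (by norm_num) (by norm_num) (by norm_num) ⟨0, rfl⟩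
        (by rw [Nat.even_iff]; norm_num)
      have c := hy 8 1 (by norm_num) (by norm_num) (by norm_num) (by norm_num) ⟨4, rfl⟩
        (by rw [Nat.even_iff]; norm_num)
      simp only at a c
      norm_num at a c
      linarith
    · have a := hx 2 1 (by norm_num) (by norm_num) (by norm_num) (by norm_num) ⟨1, rfl⟩
        (by rw [Nat.even_iff]; norm_num)
      have c := hy 2 9 (by norm_num) (by norm_num) (by norm_num) (by norm_num) ⟨1, rfl⟩
        (by rw [Nat.even_iff]; norm_num)
      simp only at a c
      norm_num at a c
      linarith
    · have a := hx 2 3 (by norm_num) (by norm_num) (by norm_num) (by norm_num) ⟨1, rfl⟩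
        (by rw [Nat.even_iff]; norm_num)
      have c := hy 10 3 (by norm_num) (by norm_num) (by norm_num) (by norm_num) ⟨5, rfl⟩
        (by rw [Nat.even_iff]; norm_num)
      simp only at a c
      norm_num at a c
      linarith
    · have a := hx 4 3 (by norm_num) (by norm_num) (by norm_num) (by norm_num) ⟨2, rfl⟩
        (by rw [Nat.even_iff]; norm_num)
      have c := hy 4 11 (by norm_num) (by norm_num) (by norm_num) (by norm_num) ⟨2, rfl⟩
        (by rw [Nat.even_iff]; norm_num)
      simp only at a c
      norm_num at a c
      linarith
    · have a := hx 4 5 (by norm_num) (by norm_num) (by norm_num) (by norm_num) ⟨2, rfl⟩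
        (by rw [Nat.even_iff]; norm_num)
      have c := hy 12 5 (by norm_num) (by norm_num) (by norm_num) (by norm_num) ⟨6, rfl⟩
        (by rw [Nat.even_iff]; norm_num)
      simp only at a c
      norm_num at a c
      linarith
    · have a := hx 6 5 (by norm_num) (by norm_num) (by norm_num) (by norm_num) ⟨3, rfl⟩
        (by rw [Nat.even_iff]; norm_num)
      have c := hy 8 13 (by norm_num) (by norm_num) (by norm_num) (by norm_num) ⟨4, rfl⟩
        (by rw [Nat.even_iff]; norm_num)
      simp only at a c
      norm_num at a c
      linarith
    · have a := hx 6 7 (by norm_num) (by norm_num) (by norm_num) (by norm_num) ⟨3, rfl⟩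
        (by rw [Nat.even_iff]; norm_num)
      have c := hy 14 9 (by norm_num) (by norm_num) (by norm_num) (by norm_num) ⟨7, rfl⟩
        (by rw [Nat.even_iff]; norm_num)
      simp only at a c
      norm_num at a c
      linarith
    · have a := hx 8 7 (by norm_num) (by norm_num) (by norm_num) (by norm_num) ⟨4, rfl⟩
        (by rw [Nat.even_iff]; norm_num)
      have c := hy 8 15 (by norm_num) (by norm_num) (by norm_num) (by norm_num) ⟨4, rfl⟩
        (by rw [Nat.even_iff]; norm_num)
      simp only at a c
      norm_num at a c
      linarith
    · have a := hx 8 15 (by norm_num) (by norm_num) (by norm_num) (by norm_num) ⟨4, rfl⟩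
        (by rw [Nat.even_iff]; norm_num)
      have c := hy 16 15 (by norm_num) (by norm_num) (by norm_num) (by norm_num) ⟨8, rfl⟩
        (by rw [Nat.even_iff]; norm_num)
      simp only at a c
      norm_num at a c
      linarith

end Summit.ValiantsHypothesis.ValiantsHypothesis.Theorems.KPlusLogSqLawStepSharp
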